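import Mathlib
import Literature.Computability.AlgebraicComplexity.FlatteningBound
import Literature.Computability.AlgebraicComplexity.KroneckerRank
import Summits.MatrixMultiplication.MatrixMultiplication.Theorems.ShapeSubmodularityShapeSubmodularStubDecompositionBound

/-!
# MatrixMultiplication / ShapeSubmodularity — `ShapeSubmodular`, the unit cell from a relative sandwich

Route `ShapeSubmodularity`, crux `ShapeSubmodular` (stmt-MatrixMultiplication-15622), line
`registered` (RESHAPE 7), stub `stub_cellOfRelSandwich`.

Write `R(X) = R(x,y,z)` for `n ↦ R⟨n^x, n^y, n^z⟩ = tensorRank (matMulTensor ℂ (n^x) (n^y) (n^z))`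
(`X = (x,y,z) ∈ ℕ³`), say `β` is *admissible* for `X` if `R(X) = O(n^β)`, and let
`L(x,y,z) = max(x+y, y+z, x+z)` be the flattening value.  For the unit cell with meet `M = (a,b,c)`,
hypothesis formats `P = (a+1,b,c)`, `Q = (a,b+1,c)`, join `J = (a+1,b+1,c)`, and `σ` the swap of the
last two coordinates (`σP = (a+1,c,b)`, `σQ = (a,c,b+1)`, same ranks by Bläser 2013, Lemma 5.5), a
*relative sandwich certificate* consists, for every `δ > 0`, of `k ≥ 1`, weights `p₁, …, p₈ ∈ ℕ`
and formats `F₁, F₂ ∈ ℕ³` with admissible `u₁`, `u₂`, such that coordinatewise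
`k·M ≤ p₁P + p₂σP + p₃Q + p₄σQ + F₁`, `k·J ≤ p₅P + p₆σP + p₇Q + p₈σQ + F₂`,
`sP := p₁+p₂+p₅+p₆ ≤ k`, `sQ := p₃+p₄+p₇+p₈ ≤ k`, and
`u₁ + u₂ + sP·L(P) + sQ·L(Q) ≤ k (L(P) + L(Q)) + δ`.  THIS STUB: such a certificate implies the
unit-square exchange law at the cell — admissible `β` for `P` and `β'` for `Q` give, for every
`ε > 0`, admissible `γ` for `J` and `γ'` for `M` with `γ + γ' ≤ β + β' + ε`.

Proof.  DECOMPOSITION BOUND (the landed stub `stub_decompositionBound` of the same line,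
imported): if `k·X ≤ Σᵢ cᵢ Yᵢ` coordinatewise (five summands) and `βᵢ` is admissible for `Yᵢ`,
then `(Σᵢ cᵢ βᵢ)/k` is admissible for `X` (Kronecker products and powers, padding, and the
homogeneity `ω(kX) = k ω(X)` in admissible-exponent form).  THE CELL: apply the certificate with
`δ = ε/2`; `β` is admissible for `σP` and `β'` for `σQ` (`R⟨k,m,l⟩ = R⟨k,l,m⟩`), so with the
summands `(P,β,p₁), (σP,β,p₂), (Q,β',p₃), (σQ,β',p₄), (F₁,u₁,1)` the exponent
`γ' = (p₁β + p₂β + p₃β' + p₄β' + u₁)/k` is admissible for `M`, and likewise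
`γ = (p₅β + p₆β + p₇β' + p₈β' + u₂)/k` for `J`.  ACCOUNTING: flattening
(`max(km, ml, kl) ≤ R⟨k,m,l⟩`, Lemma 7.1 (2)) forces `L(P) ≤ β`, `L(Q) ≤ β'`, whence
`k(γ + γ') = sP β + sQ β' + u₁ + u₂ ≤ sP (β − L(P)) + sQ (β' − L(Q)) + k (L(P) + L(Q)) + ε/2
≤ k (β + β') + ε/2 ≤ k (β + β' + ε)` using `sP, sQ ≤ k` and `k ≥ 1`.
-/

-- (single-conjunct summit: the namespace repeats MatrixMultiplication)
set_option linter.dupNamespace false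

open Filter Asymptotics
open Literature.Computability.AlgebraicComplexity

namespace Summit.MatrixMultiplication.MatrixMultiplication.Theorems.ShapeSubmodular

/-! ## `O`-bookkeeping for `ℕ`-valued sequences against real powers `n ↦ n^β` -/

/-- Eventual domination transfers `O`-bounds: if `R' n ≤ R n` for `n ≥ 1` and `R = O(n^β)`, then
`R' = O(n^β)`. [folklore] -/
private theorem rs_isBigO_of_le (R R' : ℕ → ℕ) (β : ℝ) (h : ∀ n : ℕ, 0 < n → R' n ≤ R n)
    (hO : (fun n : ℕ => (R n : ℝ)) =O[atTop] (fun n : ℕ => (n : ℝ) ^ β)) :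
    (fun n : ℕ => (R' n : ℝ)) =O[atTop] (fun n : ℕ => (n : ℝ) ^ β) := by
  refine IsBigO.trans (IsBigO.of_bound 1 ?_) hO
  filter_upwards [eventually_gt_atTop 0] with n hn
  rw [one_mul, Real.norm_of_nonneg (Nat.cast_nonneg _), Real.norm_of_nonneg (Nat.cast_nonneg _)]
  exact_mod_cast h n hn

/-- A polynomial lower bound forces the exponent: if `n^k ≤ R n` for `n ≥ 1` and `R = O(n^β)`, then
`k ≤ β` (otherwise `n^{k-β} → ∞` would be bounded). [folklore] -/
private theorem rs_le_of_isBigO (R : ℕ → ℕ) (k : ℕ) (β : ℝ)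
    (h : ∀ n : ℕ, 0 < n → n ^ k ≤ R n)
    (hO : (fun n : ℕ => (R n : ℝ)) =O[atTop] (fun n : ℕ => (n : ℝ) ^ β)) :
    (k : ℝ) ≤ β := by
  -- adapted from `Theorems.ShapeSubmodular.cell_le_of_isBigO` (stub_cellOfFlatMeet)
  by_contra hlt
  rw [not_le] at hlt
  obtain ⟨C, hC⟩ := isBigO_iff.1 hO
  have hev : ∀ᶠ n : ℕ in atTop, (n : ℝ) ^ ((k : ℝ) - β) ≤ C := by
    filter_upwards [hC, eventually_gt_atTop 0] with n hn hn0
    have hn0' : (0 : ℝ) < n := Nat.cast_pos.2 hn0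
    rw [Real.norm_of_nonneg (Nat.cast_nonneg _),
      Real.norm_of_nonneg (Real.rpow_nonneg (Nat.cast_nonneg _) _)] at hn
    have hsq : (n : ℝ) ^ (k : ℝ) ≤ C * (n : ℝ) ^ β := by
      refine le_trans ?_ hn
      rw [Real.rpow_natCast]
      exact_mod_cast h n hn0
    rw [Real.rpow_sub hn0', div_le_iff₀ (Real.rpow_pos_of_pos hn0' _)]
    exact hsq
  have hlim : Tendsto (fun n : ℕ => (n : ℝ) ^ ((k : ℝ) - β)) atTop atTop :=
    (tendsto_rpow_atTop (by linarith)).comp tendsto_natCast_atTop_atTop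
  obtain ⟨n, hn₁, hn₂⟩ := (hev.and (hlim.eventually_gt_atTop C)).exists
  exact absurd hn₁ (not_le.2 hn₂)

/-! ## Admissible exponents of natural formats: symmetry and flattening -/

/-- Swapping the last two coordinates of a format keeps its admissible exponents
(`R⟨k, m, l⟩ = R⟨k, l, m⟩`, Bläser 2013, Lemma 5.5). [cite: Blaser2013, Lemma 5.5] -/
private theorem rs_swap {x y z : ℕ} {β : ℝ}
    (h : (fun n : ℕ => (tensorRank (matMulTensor ℂ (n ^ x) (n ^ y) (n ^ z)) : ℝ)) =O[atTop]
      (fun n : ℕ => (n : ℝ) ^ β)) :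
    (fun n : ℕ => (tensorRank (matMulTensor ℂ (n ^ x) (n ^ z) (n ^ y)) : ℝ)) =O[atTop]
      (fun n : ℕ => (n : ℝ) ^ β) :=
  rs_isBigO_of_le (fun n => tensorRank (matMulTensor ℂ (n ^ x) (n ^ y) (n ^ z)))
    (fun n => tensorRank (matMulTensor ℂ (n ^ x) (n ^ z) (n ^ y))) β
    (fun n _ => ((Blaser2013_lemma55 ℂ (n ^ x) (n ^ z) (n ^ y)).2.2.2.2).le) h

/-- Flattening in exponent form: if `β` is admissible for `(x, y, z)` then
`max(x+y, y+z, x+z) ≤ β`, since `n^{max(x+y, y+z, x+z)} = max(n^x n^y, n^y n^z, n^x n^z) ≤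
R⟨n^x, n^y, n^z⟩` for `n ≥ 1` (Bläser 2013, Lemma 7.1 (2) with Lemma 5.5).
[cite: Blaser2013, Lemma 7.1 (2) and Lemma 5.5] -/
private theorem rs_flat_le {x y z : ℕ} {β : ℝ}
    (h : (fun n : ℕ => (tensorRank (matMulTensor ℂ (n ^ x) (n ^ y) (n ^ z)) : ℝ)) =O[atTop]
      (fun n : ℕ => (n : ℝ) ^ β)) :
    ((max (x + y) (max (y + z) (x + z)) : ℕ) : ℝ) ≤ β := by
  -- adapted from `Theorems.ShapeSubmodular.sandwich_pow_max_le` (stub_cellOfSandwich)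
  refine rs_le_of_isBigO (fun n => tensorRank (matMulTensor ℂ (n ^ x) (n ^ y) (n ^ z))) _ β
    (fun n hn => ?_) h
  haveI : NeZero (n ^ x) := ⟨(pow_pos hn x).ne'⟩
  haveI : NeZero (n ^ y) := ⟨(pow_pos hn y).ne'⟩
  haveI : NeZero (n ^ z) := ⟨(pow_pos hn z).ne'⟩
  have hflat := max_mul_le_tensorRank_matMulTensor ℂ (n ^ x) (n ^ y) (n ^ z)
  rw [← pow_add, ← pow_add, ← pow_add] at hflat
  refine le_trans ?_ hflat
  rcases max_choice (x + y) (max (y + z) (x + z)) with h₁ | h₁ <;> rw [h₁]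
  · exact le_max_left _ _
  · rcases max_choice (y + z) (x + z) with h₂ | h₂ <;> rw [h₂]
    · exact le_max_of_le_right (le_max_left _ _)
    · exact le_max_of_le_right (le_max_right _ _)

/-! ## The stub -/

/-- **The unit cell from a relative sandwich** (stub `stub_cellOfRelSandwich` of the line
`registered` of crux `ShapeSubmodular`): a relative sandwich certificate for the cell with meet
`M = (a,b,c)` — for every `δ > 0`, `k ≥ 1`, weights `p₁, …, p₈` and formats `F₁ = (f₁,g₁,h₁)`,
`F₂ = (f₂,g₂,h₂)` with admissible `u₁, u₂` such that `k·M ≤ p₁P + p₂σP + p₃Q + p₄σQ + F₁` and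
`k·J ≤ p₅P + p₆σP + p₇Q + p₈σQ + F₂` coordinatewise, `p₁+p₂+p₅+p₆ ≤ k`, `p₃+p₄+p₇+p₈ ≤ k` and
`u₁ + u₂ + (p₁+p₂+p₅+p₆) L(P) + (p₃+p₄+p₇+p₈) L(Q) ≤ k (L(P) + L(Q)) + δ` — implies the exchange law
at the cell: admissible `β` for `P = (a+1,b,c)` and `β'` for `Q = (a,b+1,c)` give, for every `ε > 0`,
admissible `γ` for `J = (a+1,b+1,c)` and `γ'` for `M` with `γ + γ' ≤ β + β' + ε`.  Take `δ = ε/2`,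
`γ' = ((p₁+p₂)β + (p₃+p₄)β' + u₁)/k`, `γ = ((p₅+p₆)β + (p₇+p₈)β' + u₂)/k` (decomposition bound
`stub_decompositionBound`) and use flattening `L(P) ≤ β`, `L(Q) ≤ β'` for the accounting.
[folklore] -/
theorem stub_cellOfRelSandwich :
    ∀ a b c : ℕ,
      (∀ δ : ℝ, 0 < δ → ∃ k p₁ p₂ p₃ p₄ p₅ p₆ p₇ p₈ : ℕ, ∃ f₁ g₁ h₁ f₂ g₂ h₂ : ℕ, ∃ u₁ u₂ : ℝ,
        1 ≤ k ∧ p₁ + p₂ + p₅ + p₆ ≤ k ∧ p₃ + p₄ + p₇ + p₈ ≤ k ∧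
        k * a ≤ (p₁ + p₂) * (a + 1) + (p₃ + p₄) * a + f₁ ∧
        k * b ≤ p₁ * b + p₂ * c + p₃ * (b + 1) + p₄ * c + g₁ ∧
        k * c ≤ p₁ * c + p₂ * b + p₃ * c + p₄ * (b + 1) + h₁ ∧
        k * (a + 1) ≤ (p₅ + p₆) * (a + 1) + (p₇ + p₈) * a + f₂ ∧
        k * (b + 1) ≤ p₅ * b + p₆ * c + p₇ * (b + 1) + p₈ * c + g₂ ∧
        k * c ≤ p₅ * c + p₆ * b + p₇ * c + p₈ * (b + 1) + h₂ ∧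
        (fun n : ℕ => (Literature.Computability.AlgebraicComplexity.tensorRank
          (Literature.Computability.AlgebraicComplexity.matMulTensor ℂ (n ^ f₁) (n ^ g₁) (n ^ h₁)) : ℝ))
            =O[Filter.atTop] (fun n : ℕ => (n : ℝ) ^ u₁) ∧
        (fun n : ℕ => (Literature.Computability.AlgebraicComplexity.tensorRank
          (Literature.Computability.AlgebraicComplexity.matMulTensor ℂ (n ^ f₂) (n ^ g₂) (n ^ h₂)) : ℝ))
            =O[Filter.atTop] (fun n : ℕ => (n : ℝ) ^ u₂) ∧
        u₁ + u₂ + (((p₁ + p₂ + p₅ + p₆) * (max (a + 1 + b) (max (b + c) (a + 1 + c))) + (p₃ + p₄ + p₇ + p₈) * (max (a + (b + 1)) (max (b + 1 + c) (a + c))) : ℕ) : ℝ)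
          ≤ ((k * (max (a + 1 + b) (max (b + c) (a + 1 + c)) + max (a + (b + 1)) (max (b + 1 + c) (a + c))) : ℕ) : ℝ) + δ) →
      ∀ β β' : ℝ,
      (fun n : ℕ => (Literature.Computability.AlgebraicComplexity.tensorRank
        (Literature.Computability.AlgebraicComplexity.matMulTensor ℂ (n ^ (a + 1)) (n ^ b) (n ^ c)) : ℝ))
          =O[Filter.atTop] (fun n : ℕ => (n : ℝ) ^ β) →
      (fun n : ℕ => (Literature.Computability.AlgebraicComplexity.tensorRank
        (Literature.Computability.AlgebraicComplexity.matMulTensor ℂ (n ^ a) (n ^ (b + 1)) (n ^ c)) : ℝ))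
          =O[Filter.atTop] (fun n : ℕ => (n : ℝ) ^ β') →
      ∀ ε : ℝ, 0 < ε → ∃ γ γ' : ℝ, γ + γ' ≤ β + β' + ε ∧
        (fun n : ℕ => (Literature.Computability.AlgebraicComplexity.tensorRank
          (Literature.Computability.AlgebraicComplexity.matMulTensor ℂ
            (n ^ (a + 1)) (n ^ (b + 1)) (n ^ c)) : ℝ))
            =O[Filter.atTop] (fun n : ℕ => (n : ℝ) ^ γ) ∧
        (fun n : ℕ => (Literature.Computability.AlgebraicComplexity.tensorRank
          (Literature.Computability.AlgebraicComplexity.matMulTensor ℂ (n ^ a) (n ^ b) (n ^ c)) : ℝ))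
            =O[Filter.atTop] (fun n : ℕ => (n : ℝ) ^ γ') := by
  intro a b c hRS β β' hP hQ ε hε
  obtain ⟨k, p₁, p₂, p₃, p₄, p₅, p₆, p₇, p₈, f₁, g₁, h₁, f₂, g₂, h₂, u₁, u₂, hk, hsP, hsQ,
    hMa, hMb, hMc, hJa, hJb, hJc, hF₁, hF₂, hbudget⟩ := hRS (ε / 2) (half_pos hε)
  -- `β` is admissible for `σP = (a+1, c, b)` and `β'` for `σQ = (a, c, b+1)`
  have hσP := rs_swap hP
  have hσQ := rs_swap hQ
  -- the decomposition bounds for the meet `M = (a,b,c)` and the join `J = (a+1,b+1,c)`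
  -- (summands `(P,β,pᵢ)`, `(σP,β,pᵢ₊₁)`, `(Q,β',pᵢ₊₂)`, `(σQ,β',pᵢ₊₃)`, `(Fⱼ,uⱼ,1)`)
  have hM := stub_decompositionBound a b c k hk p₁ p₂ p₃ p₄ 1 _ _ _ _ _ _ _ _ _ _ _ _ _ _ _ _ _ _ _ _
    (hMa.trans_eq (by ring)) (hMb.trans_eq (by ring)) (hMc.trans_eq (by ring)) hP hσP hQ hσQ hF₁
  have hJ := stub_decompositionBound (a + 1) (b + 1) c k hk p₅ p₆ p₇ p₈ 1
    _ _ _ _ _ _ _ _ _ _ _ _ _ _ _ _ _ _ _ _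
    (hJa.trans_eq (by ring)) (hJb.trans_eq (by ring)) (hJc.trans_eq (by ring)) hP hσP hQ hσQ hF₂
  refine ⟨_, _, ?_, hJ, hM⟩
  -- flattening on the two hypothesis formats
  have hLP : ((max (a + 1 + b) (max (b + c) (a + 1 + c)) : ℕ) : ℝ) ≤ β := rs_flat_le hP
  have hLQ : ((max (a + (b + 1)) (max (b + 1 + c) (a + c)) : ℕ) : ℝ) ≤ β' := rs_flat_le hQ
  -- accounting
  have hkpos : (0 : ℝ) < k := by exact_mod_cast hk
  have hk1 : (1 : ℝ) ≤ k := by exact_mod_cast hk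
  have hsP' : (p₁ : ℝ) + p₂ + p₅ + p₆ ≤ k := by exact_mod_cast hsP
  have hsQ' : (p₃ : ℝ) + p₄ + p₇ + p₈ ≤ k := by exact_mod_cast hsQ
  have i₁ := mul_le_mul_of_nonneg_right hsP' (sub_nonneg.2 hLP)
  have i₂ := mul_le_mul_of_nonneg_right hsQ' (sub_nonneg.2 hLQ)
  have i₃ := mul_le_mul_of_nonneg_right hk1 hε.le
  simp only [Nat.cast_add, Nat.cast_mul] at hbudget
  rw [← add_div, div_le_iff₀ hkpos]
  push_cast
  linarith

end Summit.MatrixMultiplication.MatrixMultiplication.Theorems.ShapeSubmodular
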